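import Literature.NumberTheory.GaloisRepresentations.PstWeilDeligneTwistDeRham
import Literature.NumberTheory.GaloisRepresentations.PAdicHodgeProofs
import HarnessLib

/-!
# Transport of `B`-admissibility along an equivariant isomorphism of period rings

Topic `NumberTheory/GaloisRepresentations`; theorems only (no definition, no named fact).  Generic
`p`-adic Hodge theory for the accepted `PeriodRingData` formalism (`PAdicHodge`: a Fontaine-regular
`(P, Γ)`-ring `B` with `B^Γ = E`, `D_B(V) = (B ⊗_P V)^Γ`,
`IsAdmissible 𝔅 ρ : dim_E D_B(V) = dim_P V`).

**Content.**  `B`-admissibility is transported along an equivariant isomorphism of period rings and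
restriction of the group: let `𝔅₁ = (B₁, Γ₁, E₁)` and `𝔅₂ = (B₂, Γ₂, E₂)` be period-ring data over
the same coefficient field `P`, `r : Γ₂ →ₜ* Γ₁` a continuous homomorphism and `Φ : B₁ ≃ B₂` a ring
isomorphism which is `P`-linear (`Φ ∘ algebraMap P B₁ = algebraMap P B₂`) and equivariant through
`r` (`Φ (r τ · b) = τ · Φ b`).  Then for every finite-dimensional continuous `P`-linear
representation `V` of `Γ₁`:
`V` admissible for `(B₁, Γ₁)` ⇒ `V|_r` (`ContinuousRep.restrict`) admissible for `(B₂, Γ₂)`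
(`PeriodRingData.isAdmissible_restrict_of_ringEquiv`).  This is the abstract core of the base
change of de Rham representations along an embedding `K → L` of `p`-adic fields (Brinon–Conrad 2009,
Prop. 6.3.8; a Fontaine 1994, Exp. III, Thm. 1.5.2-style transport), used with `B₁ = B_dR(K)`,
`B₂ = B_dR(L)`, `r = res_{L/K} : Γ_L → Γ_K`.

**Proof.**  By Fontaine's criterion (accepted `isAdmissible_iff_span_D_eq_top`, Exp. III,
Thm. 1.5.2) admissibility of `V` means that `D_{B}(V)` spans `B ⊗_P V` over `B`.  The `P`-linear base
change `f = Φ ⊗ 1 : B₁ ⊗_P V → B₂ ⊗_P V` is `Φ`-semilinear (`f (b • x) = Φ b • f x`,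
`map_smul_of_apply_tmul`) and intertwines the diagonal action of `r τ` on `B₁ ⊗ V` with that of `τ` on
`B₂ ⊗ V|_r` (`tensorRep_restrict_apply`), so it maps `D_{B₁}(V)` into `D_{B₂}(V|_r)`
(`apply_mem_D_restrict`) and the `B₁`-span of `D_{B₁}(V)` into the `B₂`-span of `D_{B₂}(V|_r)`
(`apply_mem_span_D_restrict`); since `f` is onto (`b ⊗ m = f (Φ⁻¹ b ⊗ m)`), the latter span is
everything.

Sources: `[cite: FontaineAsterisque223III, Exp. III Thm. 1.5.2]` (J.-M. Fontaine, *Représentations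
`p`-adiques semi-stables*, Astérisque 223 (1994), Exp. III, Thm. 1.5.2: the comparison criterion);
`[cite: BrinonConrad2009, Prop. 6.3.8]` (O. Brinon, B. Conrad, *CMI Summer School notes on `p`-adic
Hodge theory* (2009), Prop. 6.3.8: de Rham-ness is insensitive to finite extension of the base
field, via `B_dR(K) = B_dR(L)`).

What is NOT here: no converse (admissible for `(B₂, Γ₂)` ⇒ admissible for `(B₁, Γ₁)`), no
statement about the filtrations `Fil^i D` or Hodge–Tate weights, no construction of the isomorphism
`Φ` for `B_dR(K) ≃ B_dR(L)` (that is the analytic input of Brinon–Conrad, Prop. 6.3.8, supplied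
separately).
-/

noncomputable section

open scoped TensorProduct

namespace Literature.NumberTheory.GaloisRepresentations

namespace PeriodRingData

-- Mathlib's own global value of `maxSynthPendingDepth` (the project default `1` makes nested
-- instance problems on `𝔅.B ⊗[P] M` fail spuriously; see the note in `PAdicHodgeProofs`).
set_option maxSynthPendingDepth 3

universe u₁ u₂ v v₁ v₂ w₁ w₂ w'

section Transport

variable {Γ₁ : Type u₁} {Γ₂ : Type u₂} [Group Γ₁] [Group Γ₂] {P : Type v} {E₁ : Type v₁}
  {E₂ : Type v₂} [Field P] [Field E₁] [Field E₂] [Algebra P E₁] [Algebra P E₂]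
  {M : Type w'} [AddCommGroup M] [Module P M]
  (𝔅₁ : PeriodRingData.{u₁, v, v₁, w₁} Γ₁ P E₁) (𝔅₂ : PeriodRingData.{u₂, v, v₂, w₂} Γ₂ P E₂)

/-- **The base change `Φ ⊗ 1` is `Φ`-semilinear.**  If `f : B₁ ⊗_P M → B₂ ⊗_P M` is `P`-linear
and given on pure tensors by `f (b ⊗ m) = Φ b ⊗ m` for a ring isomorphism `Φ : B₁ ≃+* B₂` (only its
multiplicativity is used), then `f (b • x) = Φ b • f x` for the left `Bᵢ`-module structures on
`Bᵢ ⊗_P M` (Mathlib `TensorProduct.leftModule`). [folklore] -/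
theorem map_smul_of_apply_tmul (Φ : 𝔅₁.B ≃+* 𝔅₂.B) (f : 𝔅₁.B ⊗[P] M →ₗ[P] 𝔅₂.B ⊗[P] M)
    (hf : ∀ (b : 𝔅₁.B) (m : M), f (b ⊗ₜ m) = Φ b ⊗ₜ m) (b : 𝔅₁.B) (x : 𝔅₁.B ⊗[P] M) :
    f (b • x) = Φ b • f x := by
  induction x using TensorProduct.induction_on with
  | zero => rw [smul_zero, map_zero, smul_zero]
  | tmul b' m =>
    rw [TensorProduct.smul_tmul', smul_eq_mul, hf, map_mul, hf, TensorProduct.smul_tmul',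
      smul_eq_mul]
  | add x y hx hy => rw [smul_add, map_add, hx, hy, map_add, smul_add]

variable [TopologicalSpace Γ₁] [TopologicalSpace Γ₂] [TopologicalSpace P] [TopologicalSpace M]
  (r : Γ₂ →ₜ* Γ₁) (Φ : 𝔅₁.B ≃+* 𝔅₂.B)
  (hΦ : ∀ (τ : Γ₂) (b : 𝔅₁.B), Φ (r τ • b) = τ • Φ b)
  (f : 𝔅₁.B ⊗[P] M →ₗ[P] 𝔅₂.B ⊗[P] M) (hf : ∀ (b : 𝔅₁.B) (m : M), f (b ⊗ₜ m) = Φ b ⊗ₜ m)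
  (ρ : ContinuousRep Γ₁ P M)

include hΦ hf

/-- **`Φ ⊗ 1` intertwines the diagonal actions.**  If moreover `Φ (r τ · b) = τ · Φ b` for a
homomorphism `r : Γ₂ → Γ₁`, then `τ · f x = f (r τ · x)` for the diagonal action of `Γ₂` on
`B₂ ⊗_P V|_r` (`V|_r = ContinuousRep.restrict ρ r`) and of `Γ₁` on `B₁ ⊗_P V` (accepted
`PeriodRingData.tensorRep`). [folklore] -/
theorem tensorRep_restrict_apply (τ : Γ₂) (x : 𝔅₁.B ⊗[P] M) :
    𝔅₂.tensorRep (ρ.restrict r) τ (f x) = f (𝔅₁.tensorRep ρ (r τ) x) := by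
  induction x using TensorProduct.induction_on with
  | zero => simp only [map_zero]
  | tmul b m =>
    rw [hf, tensorRep_apply_tmul, tensorRep_apply_tmul, ContinuousRep.restrict_apply, hf, hΦ]
  | add x y hx hy => rw [map_add, map_add, hx, hy, map_add, map_add]

/-- **`Φ ⊗ 1` maps `D_{B₁}(V)` into `D_{B₂}(V|_r)`**: a `Γ₁`-invariant tensor is sent to a
`Γ₂`-invariant one (`tensorRep_restrict_apply`).  Fontaine, Exp. III §1.3 (functoriality of
`D_B`). [folklore] -/
theorem apply_mem_D_restrict {x : 𝔅₁.B ⊗[P] M} (hx : x ∈ 𝔅₁.D ρ) :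
    f x ∈ 𝔅₂.D (ρ.restrict r) :=
  (𝔅₂.mem_D_iff (ρ.restrict r) (f x)).2 fun τ => by
    rw [𝔅₁.tensorRep_restrict_apply 𝔅₂ r Φ hΦ f hf ρ τ x, (𝔅₁.mem_D_iff ρ x).1 hx (r τ)]

/-- **`Φ ⊗ 1` maps the `B₁`-span of `D_{B₁}(V)` into the `B₂`-span of `D_{B₂}(V|_r)`** (by
`Φ`-semilinearity, `map_smul_of_apply_tmul`, and `apply_mem_D_restrict`). [folklore] -/
theorem apply_mem_span_D_restrict {y : 𝔅₁.B ⊗[P] M}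
    (hy : y ∈ Submodule.span 𝔅₁.B (𝔅₁.D ρ : Set (𝔅₁.B ⊗[P] M))) :
    f y ∈ Submodule.span 𝔅₂.B (𝔅₂.D (ρ.restrict r) : Set (𝔅₂.B ⊗[P] M)) := by
  induction hy using Submodule.span_induction with
  | mem y hy => exact Submodule.subset_span (𝔅₁.apply_mem_D_restrict 𝔅₂ r Φ hΦ f hf ρ hy)
  | zero =>
    rw [map_zero]
    exact zero_mem _
  | add y z _ _ hy hz =>
    rw [map_add]
    exact add_mem hy hz
  | smul b y _ hy =>
    rw [𝔅₁.map_smul_of_apply_tmul 𝔅₂ Φ f hf b y]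
    exact Submodule.smul_mem _ _ hy

end Transport

/-- **Transport of `B`-admissibility along an equivariant isomorphism of period rings**
(the abstract core of Brinon–Conrad, Prop. 6.3.8; Fontaine, Exp. III, Thm. 1.5.2).  Let
`𝔅₁ = (B₁, Γ₁, E₁)`, `𝔅₂ = (B₂, Γ₂, E₂)` be period-ring data over the coefficient field `P`,
`r : Γ₂ →ₜ* Γ₁` a continuous homomorphism, and `Φ : B₁ ≃+* B₂` a ring isomorphism which is
`P`-linear (`hΦP`) and `r`-equivariant (`hΦ : Φ (r τ · b) = τ · Φ b`).  If the finite-dimensional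
continuous `P`-linear representation `ρ` of `Γ₁` on `V = M` is `B₁`-admissible, then its restriction
`ρ|_r = ρ.restrict r` to `Γ₂` is `B₂`-admissible.  Proof: by Fontaine's criterion (accepted
`span_D_eq_top_of_isAdmissible`, `isAdmissible_of_span_D_eq_top`) it suffices that `D_{B₂}(V|_r)`
spans `B₂ ⊗_P V` over `B₂`; the `P`-linear base change `f = Φ ⊗ 1` (Mathlib `LinearMap.rTensor` of
`AlgEquiv.ofRingEquiv hΦP`) maps the `B₁`-span of `D_{B₁}(V)`, which is everything, into the
`B₂`-span of `D_{B₂}(V|_r)` (`apply_mem_span_D_restrict`), and `f` is onto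
(`b ⊗ m = f (Φ⁻¹ b ⊗ m)`).  Used with `B₁ = B_dR(K)`, `B₂ = B_dR(L)`, `r = res_{L/K}` for a
continuous embedding `K → L` of `p`-adic fields.
[cite: BrinonConrad2009, Prop. 6.3.8] [cite: FontaineAsterisque223III, Exp. III Thm. 1.5.2] -/
theorem isAdmissible_restrict_of_ringEquiv
    {Γ₁ : Type u₁} {Γ₂ : Type u₂} [Group Γ₁] [TopologicalSpace Γ₁] [Group Γ₂] [TopologicalSpace Γ₂]
    {P : Type v} {E₁ : Type v₁} {E₂ : Type v₂} [Field P] [TopologicalSpace P] [Field E₁] [Field E₂]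
    [Algebra P E₁] [Algebra P E₂] {M : Type w'} [AddCommGroup M] [Module P M] [TopologicalSpace M]
    [FiniteDimensional P M]
    (𝔅₁ : PeriodRingData.{u₁, v, v₁, w₁} Γ₁ P E₁) (𝔅₂ : PeriodRingData.{u₂, v, v₂, w₂} Γ₂ P E₂)
    (r : Γ₂ →ₜ* Γ₁) (Φ : 𝔅₁.B ≃+* 𝔅₂.B)
    (hΦP : ∀ c : P, Φ (algebraMap P 𝔅₁.B c) = algebraMap P 𝔅₂.B c)
    (hΦ : ∀ (τ : Γ₂) (b : 𝔅₁.B), Φ (r τ • b) = τ • Φ b)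
    (ρ : ContinuousRep Γ₁ P M) (h : 𝔅₁.IsAdmissible ρ) : 𝔅₂.IsAdmissible (ρ.restrict r) := by
  -- the `P`-linear base change `f = Φ ⊗ 1`
  obtain ⟨f, hf⟩ : ∃ f : 𝔅₁.B ⊗[P] M →ₗ[P] 𝔅₂.B ⊗[P] M,
      ∀ (b : 𝔅₁.B) (m : M), f (b ⊗ₜ m) = Φ b ⊗ₜ m :=
    ⟨(AlgEquiv.ofRingEquiv (f := Φ) hΦP).toLinearMap.rTensor M, fun b m => by
      rw [LinearMap.rTensor_tmul, AlgEquiv.toLinearMap_apply, AlgEquiv.ofRingEquiv_apply]⟩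
  refine 𝔅₂.isAdmissible_of_span_D_eq_top (ρ.restrict r) (eq_top_iff.2 ?_)
  rintro z -
  induction z using TensorProduct.induction_on with
  | zero => exact zero_mem _
  | tmul b m =>
    -- `b ⊗ m = f (Φ⁻¹ b ⊗ m)` and `Φ⁻¹ b ⊗ m ∈ ⊤ = span_{B₁} D_{B₁}(V)`
    have h1 : b ⊗ₜ[P] m = f (Φ.symm b ⊗ₜ m) := by rw [hf, RingEquiv.apply_symm_apply]
    rw [h1]
    refine 𝔅₁.apply_mem_span_D_restrict 𝔅₂ r Φ hΦ f hf ρ ?_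
    rw [𝔅₁.span_D_eq_top_of_isAdmissible ρ h]
    exact Submodule.mem_top
  | add z z' hz hz' => exact add_mem hz hz'

end PeriodRingData

end Literature.NumberTheory.GaloisRepresentations

end
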